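import Literature.Barriers.PneNP.FeasibleInterpolationProofs
import Literature.Computability.MetaComplexity.EFScaffold
import Literature.Computability.MetaComplexity.EFSoundness
import HarnessLib

/-!
# `RSAPairDisjointnessEFProofs` from ONE sound rule list (Cook–Reckhow transfer), and each fixed length

Glue for the discharge of `Literature.Barriers.PneNP.FeasibleInterpolationEF` (J. Krajíček,
P. Pudlák, *Some consequences of cryptographical conjectures for `S¹₂` and `EF`*, Inform. and
Comput. 140 (1998) 82–94, Corollary 10; preprint pp. 10–11). The named fact
`Literature.Barriers.PneNP.RSAPairDisjointnessEFProofs` (`FeasibleInterpolationProofs.lean`)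
asks, for EVERY Frege rule set `F`, for polynomial-size extended Frege proofs over `F` of the
translated disjointness of the RSA pair together with the covering property of the two
translations. A construction of such proofs (e.g. with the scaffold of
`Literature/Computability/MetaComplexity/EFScaffold.lean` and its sequels) naturally produces
them over ONE convenient finite list `G` of sound schematic rules, and only for lengths
`m ≥ m₀`. This file proves, once and for all, that this suffices:

* `rsaPairDisjointnessEFProofs_of_isSound` — if `G` is sound and, for every `m ≥ m₀`, there are
  formulas `φₘ, ψₘ` with common atoms among the `3m` atoms of `n, e, y`, an extended Frege
  proof over `G` of `¬φₘ ∨ ψₘ` of size `≤ q(m)` and the two covering properties, then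
  `RSAPairDisjointnessEFProofs` holds. Proof: Cook–Reckhow's rule-by-rule translation with the
  extension axioms copied (`FregeSystem.exists_translationEF`, Cook–Reckhow 1979 Thm. 2.3 / §4,
  Krajíček 1995 §4.5: size `≤ s (B s + s) + s` for a constant `B = B(F, G)`) moves the proofs to
  any Frege system `F` (implicationally complete), and the finitely many lengths `m < m₀` are
  patched by `exists_translatedDisjointness_proof` at the cost of an additive constant;
* `exists_translatedDisjointness_proof` — for every Frege system `F` and every length `m` there
  ARE formulas `φ, ψ` over the `3m` common atoms with the covering properties and an extended
  Frege proof of `¬φ ∨ ψ` over `F` (no size bound): `φ` is the characteristic formula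
  (the list disjunction `TextbookFrege.disjList` of the `3m`-literal big conjunctions
  `PropForm.bigAnd`) of the members of `A₀` in the box `n, e, y < 2ᵐ`, `ψ`
  the negated characteristic formula of the members of `A₁`; `¬φ ∨ ψ` is a tautology by
  `rsaPair_disjoint` (Theorem 1), hence provable by completeness
  (`FregeSystem.isEFProvable_iff_isTautology`);
* `rsaPairDisjointnessEFProofs_of_isSound'` (`m₀ = 0`), `rsaPairDisjointnessEFProofs_of_isSound_pow`
  (size bound of the explicit shape `c · (m + 1)ᵏ`), and `feasibleInterpolationEF_of_isSound` —
  the same hypotheses give `FeasibleInterpolationEF` (composition with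
  `feasibleInterpolationEF_of_rsaPairDisjointnessEFProofs`);
* `Transfer.assignOf`, `Transfer.assignsTriple_of_eq_assignOf` — the canonical assignment of the
  common atoms and the criterion by which a constructed assignment (common atoms = bits of the
  triple, private atoms = witness and gate values) is shown to satisfy `AssignsTriple`.

Reused from the tree (no local copies): `PropForm.bigAnd` with `eval_bigAnd_eq_true`,
`mem_vars_bigAnd` (`EFScaffold.lean`) and `TextbookFrege.disjList` with `eval_disjList`
(`TextbookFregeCompleteness.lean`).

So the remaining debt of Corollary 10 is exactly: one sound rule list `G`, one polynomial `q`
and one `m₀` with the displayed property (the hypothesis `h` below), i.e. the formalised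
modular arithmetic inside extended Frege.

## Sources

* [KrajicekPudlak1998] proof of Cor. 10 (preprint pp. 10–11): "the translations of this formula
  into propositional calculus have polynomial size `EF`-proofs"; §1 Thm. 1 (the disjointness).
* [CookReckhow1979] Thm. 2.3, §4 (Thm. 4.5 / Cor. 4.7: all extended Frege systems over one
  basis p-simulate each other) — in the tree as `FregeSystem.exists_translationEF`.
* [Krajicek1995] §4.5 (p. 56).
-/

namespace Literature.Barriers.PneNP

open _root_.Computability Literature.Computability.Complexity Literature.Computability.MetaComplexity

/-! ### Characteristic formulas of finite sets of triples over the `3m` common atoms -/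

namespace Transfer

/-- Semantics of a literal `x` / `¬x` written with `if`. [folklore] -/
private theorem eval_ite_lit (v : ℕ) (b : Bool) (σ : ℕ → Bool) :
    (if b then PropForm.var v else PropForm.neg (PropForm.var v)).eval σ = true ↔ σ v = b := by
  cases b <;> cases h : σ v <;> simp [PropForm.eval, h]

/-- Variables of a literal written with `if`. [folklore] -/
private theorem vars_ite_lit (v : ℕ) (b : Bool) :
    (if b then PropForm.var v else PropForm.neg (PropForm.var v)).vars = {v} := by
  cases b <;> simp [PropForm.vars]

/-- Variables of a list disjunction `TextbookFrege.disjList` (`TextbookFregeCompleteness.lean`)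
lie in any set containing the variables of the members. [folklore] -/
theorem vars_disjList_subset {S : Finset ℕ} :
    ∀ {l : List (PropForm ℕ)}, (∀ φ ∈ l, φ.vars ⊆ S) → (TextbookFrege.disjList l).vars ⊆ S
  | [], _ => by simp [TextbookFrege.disjList, PropForm.vars]
  | φ :: l, h => by
    rw [TextbookFrege.disjList_cons]
    simp only [PropForm.vars]
    exact Finset.union_subset (h φ (by simp)) (vars_disjList_subset fun χ hχ => h χ (by simp [hχ]))

/-- The characteristic term of a triple `t = (n, e, y)` in width `m`: the big conjunction
(`PropForm.bigAnd`, `EFScaffold.lean`) of the `3m` literals fixing the common atoms to the bits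
of the triple (atom `i`: bit `i` of `n`; atom `m + i`: bit `i` of `e`; atom `2m + i`: bit `i`
of `y`), cf. `AssignsTriple`. [cite: KrajicekPudlak1998, §3 (preprint p. 9: "a truth assignment `x` for `p`")] -/
def charForm (m : ℕ) (t : ℕ × ℕ × ℕ) : PropForm ℕ :=
  PropForm.bigAnd ((List.range m).flatMap fun i =>
    [if t.1.testBit i then PropForm.var i else PropForm.neg (PropForm.var i),
      if t.2.1.testBit i then PropForm.var (m + i) else PropForm.neg (PropForm.var (m + i)),
      if t.2.2.testBit i then PropForm.var (2 * m + i)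
        else PropForm.neg (PropForm.var (2 * m + i))])

/-- The characteristic term of `(n, e, y)` holds under `σ` iff `σ` carries the triple on the
`3m` common atoms. [folklore] -/
theorem eval_charForm (m n e y : ℕ) (σ : ℕ → Bool) :
    (charForm m (n, e, y)).eval σ = true ↔ AssignsTriple m n e y σ := by
  simp only [charForm, PropForm.eval_bigAnd_eq_true, List.mem_flatMap, List.mem_range,
    List.mem_cons, List.not_mem_nil, or_false, AssignsTriple]
  constructor
  · intro h i hi
    exact ⟨(eval_ite_lit _ _ σ).1 (h _ ⟨i, hi, Or.inl rfl⟩),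
      (eval_ite_lit _ _ σ).1 (h _ ⟨i, hi, Or.inr (Or.inl rfl)⟩),
      (eval_ite_lit _ _ σ).1 (h _ ⟨i, hi, Or.inr (Or.inr rfl)⟩)⟩
  · rintro h φ ⟨i, hi, rfl | rfl | rfl⟩
    exacts [(eval_ite_lit _ _ σ).2 (h i hi).1, (eval_ite_lit _ _ σ).2 (h i hi).2.1,
      (eval_ite_lit _ _ σ).2 (h i hi).2.2]

/-- The characteristic term only mentions the `3m` common atoms. [folklore] -/
theorem vars_charForm_subset (m : ℕ) (t : ℕ × ℕ × ℕ) :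
    (charForm m t).vars ⊆ Finset.range (3 * m) := by
  intro x hx
  obtain ⟨φ, hφ, hxφ⟩ := PropForm.mem_vars_bigAnd.1 hx
  simp only [List.mem_flatMap, List.mem_range, List.mem_cons, List.not_mem_nil, or_false] at hφ
  obtain ⟨i, hi, rfl | rfl | rfl⟩ := hφ <;>
    simp only [vars_ite_lit, Finset.mem_singleton] at hxφ <;> subst hxφ <;>
    simp only [Finset.mem_range] <;> omega

/-- The canonical assignment carrying `(n, e, y)` in width `m`. [folklore] -/
def assignOf (m : ℕ) (t : ℕ × ℕ × ℕ) (v : ℕ) : Bool :=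
  if v < m then t.1.testBit v else if v < 2 * m then t.2.1.testBit (v - m)
    else t.2.2.testBit (v - 2 * m)

/-- `assignOf` carries the triple. [folklore] -/
theorem assignsTriple_assignOf (m n e y : ℕ) : AssignsTriple m n e y (assignOf m (n, e, y)) := by
  intro i hi
  refine ⟨by simp [assignOf, hi], ?_, ?_⟩
  · have h1 : ¬ m + i < m := by omega
    have h2 : m + i < 2 * m := by omega
    simp [assignOf, h1, h2]
  · have h1 : ¬ 2 * m + i < m := by omega
    have h2 : ¬ 2 * m + i < 2 * m := by omega
    simp [assignOf, h1, h2]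

/-- An assignment agreeing with `assignOf m (n, e, y)` on the `3m` common atoms carries the
triple (the form in which a constructed satisfying assignment — common atoms set to the bits of
the triple, private atoms set to witness and gate values — is shown to carry it). [folklore] -/
theorem assignsTriple_of_eq_assignOf {m n e y : ℕ} {σ : ℕ → Bool}
    (h : ∀ v < 3 * m, σ v = assignOf m (n, e, y) v) : AssignsTriple m n e y σ := by
  intro i hi
  have a := assignsTriple_assignOf m n e y i hi
  rw [← h i (by omega), ← h (m + i) (by omega), ← h (2 * m + i) (by omega)] at a
  exact a

/-- Conversely, an assignment carrying the triple agrees with `assignOf` on the `3m` common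
atoms. [folklore] -/
theorem eq_assignOf_of_assignsTriple {m n e y : ℕ} {σ : ℕ → Bool} (h : AssignsTriple m n e y σ)
    {v : ℕ} (hv : v < 3 * m) : σ v = assignOf m (n, e, y) v := by
  have a := assignsTriple_assignOf m n e y
  by_cases h₁ : v < m
  · rw [(h v h₁).1, (a v h₁).1]
  by_cases h₂ : v < 2 * m
  · obtain ⟨i, rfl⟩ : ∃ i, v = m + i := ⟨v - m, by omega⟩
    rw [(h i (by omega)).2.1, (a i (by omega)).2.1]
  · obtain ⟨i, rfl⟩ : ∃ i, v = 2 * m + i := ⟨v - 2 * m, by omega⟩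
    rw [(h i (by omega)).2.2, (a i (by omega)).2.2]

/-- Two numbers `< 2ᵐ` carried by the same atoms are equal. [folklore] -/
theorem eq_of_testBit_eq_below {m a b : ℕ} (ha : a < 2 ^ m) (hb : b < 2 ^ m)
    (h : ∀ i < m, a.testBit i = b.testBit i) : a = b := by
  refine Nat.eq_of_testBit_eq fun i => ?_
  by_cases hi : i < m
  · exact h i hi
  · have hm : 2 ^ m ≤ 2 ^ i := Nat.pow_le_pow_right (by norm_num) (by omega)
    rw [Nat.testBit_eq_false_of_lt (lt_of_lt_of_le ha hm),
      Nat.testBit_eq_false_of_lt (lt_of_lt_of_le hb hm)]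

/-- An assignment carries at most one triple of numbers `< 2ᵐ`. [folklore] -/
theorem assignsTriple_unique {m n e y n' e' y' : ℕ} {σ : ℕ → Bool}
    (h : AssignsTriple m n e y σ) (h' : AssignsTriple m n' e' y' σ)
    (hn : n < 2 ^ m) (he : e < 2 ^ m) (hy : y < 2 ^ m)
    (hn' : n' < 2 ^ m) (he' : e' < 2 ^ m) (hy' : y' < 2 ^ m) :
    n = n' ∧ e = e' ∧ y = y' :=
  ⟨eq_of_testBit_eq_below hn hn' fun i hi => ((h i hi).1.symm.trans (h' i hi).1),
    eq_of_testBit_eq_below he he' fun i hi => ((h i hi).2.1.symm.trans (h' i hi).2.1),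
    eq_of_testBit_eq_below hy hy' fun i hi => ((h i hi).2.2.symm.trans (h' i hi).2.2)⟩

open Classical in
/-- The members of `Aᵢ = rsaPair i` in the box `n, e, y < 2ᵐ`, as a list. [cite: KrajicekPudlak1998, §1 (preprint p. 3)] -/
noncomputable def boxMembers (i m : ℕ) : List (ℕ × ℕ × ℕ) :=
  ((List.range (2 ^ m)) ×ˢ ((List.range (2 ^ m)) ×ˢ (List.range (2 ^ m)))).filter
    fun t => decide (t ∈ rsaPair i)

/-- Membership in `boxMembers`. [folklore] -/
theorem mem_boxMembers {i m n e y : ℕ} :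
    (n, e, y) ∈ boxMembers i m ↔ n < 2 ^ m ∧ e < 2 ^ m ∧ y < 2 ^ m ∧ (n, e, y) ∈ rsaPair i := by
  simp [boxMembers, and_assoc]

/-- The characteristic formula of `Aᵢ ∩ {n, e, y < 2ᵐ}` over the `3m` common atoms.
[cite: KrajicekPudlak1998, proof of Cor. 10 (preprint p. 10: the propositional translations)] -/
noncomputable def boxForm (i m : ℕ) : PropForm ℕ :=
  TextbookFrege.disjList ((boxMembers i m).map (charForm m))

/-- Semantics of `boxForm`: true under `σ` iff `σ` carries some member of `Aᵢ` in the box.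
[folklore] -/
theorem eval_boxForm_iff {i m : ℕ} {σ : ℕ → Bool} :
    (boxForm i m).eval σ = true ↔ ∃ n e y, n < 2 ^ m ∧ e < 2 ^ m ∧ y < 2 ^ m ∧
      (n, e, y) ∈ rsaPair i ∧ AssignsTriple m n e y σ := by
  simp only [boxForm, TextbookFrege.eval_disjList, List.mem_map, exists_exists_and_eq_and]
  constructor
  · rintro ⟨⟨n, e, y⟩, ht, hev⟩
    rw [mem_boxMembers] at ht
    exact ⟨n, e, y, ht.1, ht.2.1, ht.2.2.1, ht.2.2.2, (eval_charForm m n e y σ).1 hev⟩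
  · rintro ⟨n, e, y, hn, he, hy, ht, hσ⟩
    exact ⟨(n, e, y), mem_boxMembers.2 ⟨hn, he, hy, ht⟩, (eval_charForm m n e y σ).2 hσ⟩

/-- `boxForm` only mentions the `3m` common atoms. [folklore] -/
theorem vars_boxForm_subset (i m : ℕ) : (boxForm i m).vars ⊆ Finset.range (3 * m) := by
  refine vars_disjList_subset fun φ hφ => ?_
  obtain ⟨t, -, rfl⟩ := List.mem_map.1 hφ
  exact vars_charForm_subset m t

/-- **The translated disjointness at a fixed length is a tautology** (Theorem 1 read
propositionally): `¬ boxForm 0 m ∨ ¬ boxForm 1 m`. [cite: KrajicekPudlak1998, Thm. 1 (preprint pp. 3–4)] -/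
theorem isTautology_boxForm (m : ℕ) :
    (PropForm.disj (PropForm.neg (boxForm 0 m)) (PropForm.neg (boxForm 1 m))).IsTautology := by
  intro σ
  simp only [PropForm.eval]
  cases h₀ : (boxForm 0 m).eval σ
  · simp
  cases h₁ : (boxForm 1 m).eval σ
  · simp
  exfalso
  obtain ⟨n, e, y, hn, he, hy, ht, hσ⟩ := eval_boxForm_iff.1 h₀
  obtain ⟨n', e', y', hn', he', hy', ht', hσ'⟩ := eval_boxForm_iff.1 h₁
  obtain ⟨rfl, rfl, rfl⟩ := assignsTriple_unique hσ hσ' hn he hy hn' he' hy'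
  exact Set.disjoint_left.1 rsaPair_disjoint ht ht'

end Transfer

open Transfer in
/-- **Each fixed length of the translated disjointness is provable in every extended Frege
system** (no size bound): for a Frege system `F` and a length `m` there are formulas `φ, ψ`
whose common atoms are among the `3m` atoms of `n, e, y`, with the covering properties of
`RSAPairDisjointnessEFProofs`, and an extended Frege proof of `¬φ ∨ ψ` over `F` — the
characteristic formulas of `A₀`, `A₁` in the box `n, e, y < 2ᵐ` (`Transfer.boxForm`), a
tautology by Theorem 1 (`rsaPair_disjoint`), provable by the completeness of `F`
(`FregeSystem.isEFProvable_iff_isTautology`). Used to patch finitely many small lengths in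
`rsaPairDisjointnessEFProofs_of_isSound`. [cite: KrajicekPudlak1998, Thm. 1 (preprint pp. 3–4) and proof of Cor. 10 (preprint p. 10)] [cite: CookReckhow1979, §2 Def. 2.2 (implicational completeness)] -/
theorem exists_translatedDisjointness_proof {F : FregeSystem} (hF : IsFrege F) (m : ℕ) :
    ∃ (φ ψ : PropForm ℕ) (π : List (PropForm ℕ)),
      φ.vars ∩ ψ.vars ⊆ Finset.range (3 * m) ∧
      F.IsEFProofOf π (PropForm.disj (PropForm.neg φ) ψ) ∧
      (∀ n e y : ℕ, n < 2 ^ m → e < 2 ^ m → y < 2 ^ m → (n, e, y) ∈ rsaPair 0 →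
        ∃ σ : ℕ → Bool, AssignsTriple m n e y σ ∧ φ.eval σ = true) ∧
      (∀ n e y : ℕ, n < 2 ^ m → e < 2 ^ m → y < 2 ^ m → (n, e, y) ∈ rsaPair 1 →
        ∃ σ : ℕ → Bool, AssignsTriple m n e y σ ∧ ψ.eval σ = false) := by
  obtain ⟨π, hπ⟩ := (FregeSystem.isEFProvable_iff_isTautology hF).2 (isTautology_boxForm m)
  refine ⟨boxForm 0 m, PropForm.neg (boxForm 1 m), π,
    Finset.inter_subset_left.trans (vars_boxForm_subset 0 m), hπ, ?_, ?_⟩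
  · intro n e y hn he hy ht
    exact ⟨assignOf m (n, e, y), assignsTriple_assignOf m n e y,
      eval_boxForm_iff.2 ⟨n, e, y, hn, he, hy, ht, assignsTriple_assignOf m n e y⟩⟩
  · intro n e y hn he hy ht
    refine ⟨assignOf m (n, e, y), assignsTriple_assignOf m n e y, ?_⟩
    have h := eval_boxForm_iff.2 ⟨n, e, y, hn, he, hy, ht, assignsTriple_assignOf m n e y⟩
    simp [PropForm.eval, h]

open Polynomial in
/-- **`RSAPairDisjointnessEFProofs` from one sound rule list (Cook–Reckhow transfer).** If `G`
is a sound finite list of schematic rules and, for every length `m ≥ m₀`, there are formulas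
`φ, ψ` with common atoms among the `3m` atoms of `n, e, y`, an extended Frege proof over `G` of
`¬φ ∨ ψ` of size `≤ q(m)`, and the covering properties (members of `A₀` in the box extend to
satisfying assignments of `φ`, members of `A₁` to falsifying assignments of `ψ`), then the same
holds over EVERY Frege system with a polynomial bound, i.e. `RSAPairDisjointnessEFProofs`. The
proofs are moved to a Frege system `F` by Cook–Reckhow's translation of extended Frege proofs
(`FregeSystem.exists_translationEF`: rules of `G` replaced by fixed `F`-derivations, extension
axioms copied; size `≤ s (B s + s) + s`), which needs only the soundness of `G` and the
implicational completeness of `F`; the lengths `m < m₀` contribute an additive constant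
(`exists_translatedDisjointness_proof`). This is the form in which "the translations … have
polynomial size `EF`-proofs" is independent of the particular extended Frege system ("any two
extended Frege systems p-simulate each other"). [cite: KrajicekPudlak1998, proof of Cor. 10 (preprint pp. 10–11)] [cite: CookReckhow1979, Thm. 2.3 and §4 (Thm. 4.5 / Cor. 4.7)] [cite: Krajicek1995, §4.5 p. 56] -/
theorem rsaPairDisjointnessEFProofs_of_isSound {G : FregeSystem} (hG : G.IsSound) (m₀ : ℕ)
    (q : Polynomial ℕ)
    (h : ∀ m : ℕ, m₀ ≤ m → ∃ (φ ψ : PropForm ℕ) (π : List (PropForm ℕ)),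
      φ.vars ∩ ψ.vars ⊆ Finset.range (3 * m) ∧
      G.IsEFProofOf π (PropForm.disj (PropForm.neg φ) ψ) ∧
      proofSize π ≤ q.eval m ∧
      (∀ n e y : ℕ, n < 2 ^ m → e < 2 ^ m → y < 2 ^ m → (n, e, y) ∈ rsaPair 0 →
        ∃ σ : ℕ → Bool, AssignsTriple m n e y σ ∧ φ.eval σ = true) ∧
      (∀ n e y : ℕ, n < 2 ^ m → e < 2 ^ m → y < 2 ^ m → (n, e, y) ∈ rsaPair 1 →
        ∃ σ : ℕ → Bool, AssignsTriple m n e y σ ∧ ψ.eval σ = false)) :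
    RSAPairDisjointnessEFProofs := by
  intro F hF
  obtain ⟨B, hB⟩ := FregeSystem.exists_translationEF (F₁ := F) (F₂ := G) hF.2 hG
  -- the finitely many small lengths, over `F` directly
  choose φs ψs πs hvs hπs hc₀ hc₁ using fun m => exists_translatedDisjointness_proof hF m
  set c : ℕ := ∑ m ∈ Finset.range m₀, proofSize (πs m) with hc
  refine ⟨q * (C B * q + q) + q + C c, fun m => ?_⟩
  by_cases hm : m₀ ≤ m
  · obtain ⟨φ, ψ, π, hv, hπ, hs, h₀, h₁⟩ := h m hm
    obtain ⟨π', hπ', hs'⟩ := hB π _ hπ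
    refine ⟨φ, ψ, π', hv, hπ', hs'.trans ?_, h₀, h₁⟩
    simp only [eval_add, eval_mul, eval_C]
    calc proofSize π * (B * proofSize π + proofSize π) + proofSize π
        ≤ q.eval m * (B * q.eval m + q.eval m) + q.eval m :=
          Nat.add_le_add (Nat.mul_le_mul hs (Nat.add_le_add (Nat.mul_le_mul_left _ hs) hs)) hs
      _ ≤ q.eval m * (B * q.eval m + q.eval m) + q.eval m + c := Nat.le_add_right _ _
  · refine ⟨φs m, ψs m, πs m, hvs m, hπs m, ?_, hc₀ m, hc₁ m⟩
    have hle : proofSize (πs m) ≤ c := by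
      rw [hc]
      exact Finset.single_le_sum (f := fun k => proofSize (πs k)) (fun _ _ => Nat.zero_le _)
        (Finset.mem_range.2 (by omega))
    simp only [eval_add, eval_mul, eval_C]
    omega

/-- `RSAPairDisjointnessEFProofs` from one sound rule list, all lengths (`m₀ = 0`).
[cite: KrajicekPudlak1998, proof of Cor. 10 (preprint pp. 10–11)] [cite: CookReckhow1979, Thm. 2.3 and §4] -/
theorem rsaPairDisjointnessEFProofs_of_isSound' {G : FregeSystem} (hG : G.IsSound)
    (q : Polynomial ℕ)
    (h : ∀ m : ℕ, ∃ (φ ψ : PropForm ℕ) (π : List (PropForm ℕ)),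
      φ.vars ∩ ψ.vars ⊆ Finset.range (3 * m) ∧
      G.IsEFProofOf π (PropForm.disj (PropForm.neg φ) ψ) ∧
      proofSize π ≤ q.eval m ∧
      (∀ n e y : ℕ, n < 2 ^ m → e < 2 ^ m → y < 2 ^ m → (n, e, y) ∈ rsaPair 0 →
        ∃ σ : ℕ → Bool, AssignsTriple m n e y σ ∧ φ.eval σ = true) ∧
      (∀ n e y : ℕ, n < 2 ^ m → e < 2 ^ m → y < 2 ^ m → (n, e, y) ∈ rsaPair 1 →
        ∃ σ : ℕ → Bool, AssignsTriple m n e y σ ∧ ψ.eval σ = false)) :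
    RSAPairDisjointnessEFProofs :=
  rsaPairDisjointnessEFProofs_of_isSound hG 0 q fun m _ => h m

open Polynomial in
/-- `RSAPairDisjointnessEFProofs` from one sound rule list with a size bound of the explicit
shape `c · (m + 1)ᵏ` for `m ≥ m₀` (the polynomial is supplied here: `C c * (X + 1) ^ k`).
[cite: KrajicekPudlak1998, proof of Cor. 10 (preprint pp. 10–11)] [cite: CookReckhow1979, Thm. 2.3 and §4] -/
theorem rsaPairDisjointnessEFProofs_of_isSound_pow {G : FregeSystem} (hG : G.IsSound)
    (m₀ c k : ℕ)
    (h : ∀ m : ℕ, m₀ ≤ m → ∃ (φ ψ : PropForm ℕ) (π : List (PropForm ℕ)),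
      φ.vars ∩ ψ.vars ⊆ Finset.range (3 * m) ∧
      G.IsEFProofOf π (PropForm.disj (PropForm.neg φ) ψ) ∧
      proofSize π ≤ c * (m + 1) ^ k ∧
      (∀ n e y : ℕ, n < 2 ^ m → e < 2 ^ m → y < 2 ^ m → (n, e, y) ∈ rsaPair 0 →
        ∃ σ : ℕ → Bool, AssignsTriple m n e y σ ∧ φ.eval σ = true) ∧
      (∀ n e y : ℕ, n < 2 ^ m → e < 2 ^ m → y < 2 ^ m → (n, e, y) ∈ rsaPair 1 →
        ∃ σ : ℕ → Bool, AssignsTriple m n e y σ ∧ ψ.eval σ = false)) :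
    RSAPairDisjointnessEFProofs := by
  refine rsaPairDisjointnessEFProofs_of_isSound hG m₀ (C c * (X + 1) ^ k) fun m hm => ?_
  obtain ⟨φ, ψ, π, hv, hπ, hs, h₀, h₁⟩ := h m hm
  exact ⟨φ, ψ, π, hv, hπ, by simpa [eval_add, eval_mul, eval_pow, eval_C, eval_X] using hs,
    h₀, h₁⟩

/-- **Corollary 10 from one sound rule list**: under the hypotheses of
`rsaPairDisjointnessEFProofs_of_isSound`, the barrier fact `FeasibleInterpolationEF` holds
(composition with the proved circuit half
`feasibleInterpolationEF_of_rsaPairDisjointnessEFProofs`). [cite: KrajicekPudlak1998, Cor. 10 (preprint pp. 10–11)] -/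
theorem feasibleInterpolationEF_of_isSound {G : FregeSystem} (hG : G.IsSound) (m₀ : ℕ)
    (q : Polynomial ℕ)
    (h : ∀ m : ℕ, m₀ ≤ m → ∃ (φ ψ : PropForm ℕ) (π : List (PropForm ℕ)),
      φ.vars ∩ ψ.vars ⊆ Finset.range (3 * m) ∧
      G.IsEFProofOf π (PropForm.disj (PropForm.neg φ) ψ) ∧
      proofSize π ≤ q.eval m ∧
      (∀ n e y : ℕ, n < 2 ^ m → e < 2 ^ m → y < 2 ^ m → (n, e, y) ∈ rsaPair 0 →
        ∃ σ : ℕ → Bool, AssignsTriple m n e y σ ∧ φ.eval σ = true) ∧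
      (∀ n e y : ℕ, n < 2 ^ m → e < 2 ^ m → y < 2 ^ m → (n, e, y) ∈ rsaPair 1 →
        ∃ σ : ℕ → Bool, AssignsTriple m n e y σ ∧ ψ.eval σ = false)) :
    FeasibleInterpolationEF :=
  feasibleInterpolationEF_of_rsaPairDisjointnessEFProofs
    (rsaPairDisjointnessEFProofs_of_isSound hG m₀ q h)

end Literature.Barriers.PneNP
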